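import Literature.Probability.Distributions.PseudoGaussianSamplerTV
import Literature.Algebra.EuclideanLattices.DiscreteGaussianInt
import Mathlib.Analysis.SpecialFunctions.ImproperIntegrals
import Mathlib.Analysis.SumIntegralComparisons
import HarnessLib

/-!
# The pseudo-Gaussian sampler is statistically close to the discrete Gaussian `D_{ℤ, 2ᵇ√π}`

Topic `Probability/Distributions`, sequel of `PseudoGaussianSampler.lean` (the coin-driven sampler with
parameters `P : PGParams` — mesh `h = 2^{-b}`, range `T = 2^{r+b}`, `R = Th = 2^r`, acceptance
granularity `q = 2^{-k}`, `J` attempts — and its exact law `ℓ' = P.law` on `(-T, T)`),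
`PseudoGaussianSamplerEstimates.lean` (`exp_le_phi`, `A_le`, `phi_div_mul_le_law`) and
`PseudoGaussianSamplerTV.lean` (statistical distance to the ROUNDED continuous Gaussian). The lattice
reductions of the tree (Micciancio–Regev 2007, Thm. 5.9 / Cor. 5.13 / Thm. 5.23 behind
`Literature.Computability.Cryptography.owfExist_of_gapSVP_worstCaseHard`; the fine-grid sampling lemma
`Literature.Algebra.EuclideanLattices.MicciancioRegev2007.map_gridSample_apply`, GPV's SampleZ) are
analysed for the DISCRETE Gaussian `D_{ℤ,s,c}(j) ∝ ρ_s(j - c) = e^{-π(j-c)²/s²}`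
(`Literature.Algebra.EuclideanLattices.discreteGaussianInt`), sampled coordinate by coordinate on the
grid; a bit-level machine running the coin-driven sampler therefore needs `Δ(ℓ', D_{ℤ,s,0})` small for
the parameter its acceptance profile matches, `e^{-(jh)²} = e^{-πj²/s²}`, i.e. **`s = √π/h = 2ᵇ√π`**
(`PGParams.sZ`). This file proves it, in the same one-sided way as the rounded-Gaussian comparison but
with sums in place of integrals:

* `tvDist_le_of_le_mul_on` — **generic**: for laws `ν, μ` on a type with `ν` supported in a finite
  set `S` and `μ ≤ F·ν` on `S` (`F ≥ 1`), `Δ(ν, μ) ≤ (F - 1) + μ(Sᶜ)`.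
* `PGParams.sZ`, `gaussianFunction_sZ` (`ρ_{s}(x) = e^{-(xh)²}`), `toReal_discreteGaussianInt_sZ`
  (`D(j) = e^{-(jh)²}/Z`, `Z = ∑_{j ∈ ℤ} e^{-(jh)²}`), the mass bounds `sum_Ioo_le_Z`
  (`Z ≥ ∑_{|j|<T} e^{-(jh)²} ≥ (√π - 2e^{-R})/h - 1`, Riemann sum) and the tail
  `Z_sub_sum_Ioo_le` (`∑_{|j| ≥ T} e^{-(jh)²} ≤ 2e^{-(R-h)²}/(h(R-h))`, comparison with
  `∫_{T-1}^∞ e^{-h²(T-1)x} dx`).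
* `discreteGaussianInt_le_mul_law` — the domination on the range: for `|j| < T`,
  `D(j) ≤ F·ℓ'(j)` with `F = e^{2qR² + q}(√π + h)/((1 - p₀^J)(√π - 2e^{-R} - h))`
  (`ℓ' ≥ (1 - p₀^J)φ/A`, `φ ≥ e^{-(1+2q)(jh)²} ≥ e^{-2qR²}ρ_s(j)`, `A ≤ e^q(1 + √π/h)`, `Z ≥ …`).
* **`PGParams.tvDist_lawPMF_discreteGaussianInt_le`** — for `k, b ≥ 1`, `R - h ≥ 1`, `p₀^J < 1`:
  `Δ(ℓ', D_{ℤ, 2ᵇ√π, 0}) ≤ (F - 1) + 2e^{-(R-h)²}/((R-h)(√π - 2e^{-R} - h))`; every term is small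
  for `qR² → 0`, `h → 0`, `p₀^J → 0` (`pNone_pow_le`), `R → ∞` — with a budget of `2^{2r+k}`
  acceptance blocks the accuracy is `Θ(R² 2^{-k})`, polynomially (not negligibly) small.

Shifting by an integer `c` (`j ↦ j + c`) then gives `D_{ℤ,s,c}` at the same distance (not needed here).
All proved; one definition with body (`PGParams.sZ`), no named fact.

## References

* J. von Neumann, *Various techniques used in connection with random digits*, NBS Appl. Math. Ser. 12
  (1951) 36–38; C. F. F. Karney, *Sampling exactly from the normal distribution*, ACM TOMS 42 (2016),
  §2 (coin-realised acceptance `e^{-x}`) — the sampler.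
* C. Gentry, C. Peikert, V. Vaikuntanathan, *Trapdoors for hard lattices and new cryptographic
  constructions*, STOC 2008, §4.1 (SampleZ: the consumer needs `D_{ℤ,s,c}` within small statistical
  distance) [GentryPeikertVaikuntanathan2008].
* O. Goldreich, *Foundations of Cryptography I*, CUP 2001, §3.2.1 (statistical distance) [Goldreich2001].
-/

noncomputable section

namespace Literature.Probability.Distributions

open MeasureTheory Real Finset Literature.Algebra.EuclideanLattices
open scoped ENNReal

/-! ### One-sided domination bounds the statistical distance -/

/-- **One-sided domination bounds the statistical distance.** For probability mass functions `ν, μ`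
with `ν` supported in the finite set `S` and `μ ≤ F·ν` on `S` (`F ≥ 1`):
`Δ(ν, μ) = ∑ (μ - ν)⁺ ≤ (F - 1) + μ(Sᶜ)`. [cite: Goldreich2001, §3.2.1] -/
theorem tvDist_le_of_le_mul_on {α : Type*} [DecidableEq α] (ν μ : PMF α) (S : Finset α)
    (hν : ∀ a ∉ S, ν a = 0) {F : ℝ} (hF : 1 ≤ F)
    (hdom : ∀ a ∈ S, (μ a).toReal ≤ F * (ν a).toReal) :
    ν.tvDist μ ≤ (F - 1) + (μ.toOuterMeasure ((↑S : Set α)ᶜ)).toReal := by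
  set m : α → ℝ := fun a => (μ a).toReal with hm
  set n : α → ℝ := fun a => (ν a).toReal with hn
  have hn_nonneg : ∀ a, 0 ≤ n a := fun a => ENNReal.toReal_nonneg
  have hm_nonneg : ∀ a, 0 ≤ m a := fun a => ENNReal.toReal_nonneg
  have hmsum : Summable m := PMF.summable_coe_toReal μ
  have hm1 : ∑' a, m a = 1 := PMF.tsum_coe_toReal μ
  have hn0 : ∀ a ∉ S, n a = 0 := fun a ha => by simp [hn, hν a ha]
  have hnsum : Summable n := summable_of_ne_finset_zero hn0
  have hn1 : ∑' a, n a = 1 := PMF.tsum_coe_toReal ν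
  -- the dominating function
  set g : α → ℝ := fun a => if a ∈ S then (F - 1) * n a else m a with hg
  have hdom' : ∀ a, m a - n a ≤ g a := by
    intro a
    by_cases ha : a ∈ S
    · simp only [hg, if_pos ha]
      have := hdom a ha
      linarith
    · simp only [hg, if_neg ha]
      linarith [hn_nonneg a]
  have hpos : ∀ a, max (m a - n a) 0 ≤ g a := by
    intro a
    refine max_le (hdom' a) ?_
    by_cases ha : a ∈ S
    · simp only [hg, if_pos ha]; exact mul_nonneg (by linarith) (hn_nonneg a)
    · simp only [hg, if_neg ha]; exact hm_nonneg a
  have habs : ∀ a, |n a - m a| = (n a - m a) + 2 * max (m a - n a) 0 := by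
    intro a
    rcases le_or_gt (m a) (n a) with h | h
    · rw [max_eq_right (by linarith), abs_of_nonneg (by linarith)]; ring
    · rw [max_eq_left (by linarith), abs_of_neg (by linarith)]; ring
  have hmaxsum : Summable fun a => max (m a - n a) 0 :=
    Summable.of_nonneg_of_le (fun a => le_max_right _ _)
      (fun a => max_le ((sub_le_self _ (hn_nonneg a)).trans (le_abs_self _)) (abs_nonneg _)) hmsum.abs
  -- split `g` into the range part and the tail part
  have hgsplit : ∀ a, g a = (if a ∈ S then (F - 1) * n a else 0) + (if a ∈ S then 0 else m a) := by
    intro a; by_cases ha : a ∈ S <;> simp [hg, ha]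
  have hg1sum : Summable fun a => if a ∈ S then (F - 1) * n a else 0 := by
    refine summable_of_ne_finset_zero (s := S) fun a ha => ?_
    rw [if_neg ha]
  have hg2sum : Summable fun a => if a ∈ S then 0 else m a :=
    Summable.of_nonneg_of_le (fun a => by split_ifs <;> [exact le_rfl; exact hm_nonneg a])
      (fun a => by split_ifs <;> [exact hm_nonneg a; exact le_rfl]) hmsum
  have hgsum : Summable g := (hg1sum.add hg2sum).congr fun a => (hgsplit a).symm
  -- (1) the range part
  have h1 : ∑' a, (if a ∈ S then (F - 1) * n a else 0) ≤ F - 1 := by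
    have hle : ∀ a, (if a ∈ S then (F - 1) * n a else 0) ≤ (F - 1) * n a := by
      intro a; split_ifs
      · exact le_rfl
      · exact mul_nonneg (by linarith) (hn_nonneg a)
    calc ∑' a, (if a ∈ S then (F - 1) * n a else 0) ≤ ∑' a, (F - 1) * n a :=
          hg1sum.tsum_le_tsum hle (hnsum.mul_left _)
      _ = F - 1 := by rw [tsum_mul_left, hn1, mul_one]
  -- (2) the tail part is `μ(Sᶜ)`
  have h2 : ∑' a, (if a ∈ S then 0 else m a) = (μ.toOuterMeasure ((↑S : Set α)ᶜ)).toReal := by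
    rw [PMF.toOuterMeasure_apply, ENNReal.tsum_toReal_eq (fun a => by
      refine ne_top_of_le_ne_top (PMF.apply_ne_top μ a) ?_
      exact Set.indicator_le_self _ _ a)]
    refine tsum_congr fun a => ?_
    by_cases ha : a ∈ S
    · rw [Set.indicator_of_notMem (by simpa using ha), if_pos ha, ENNReal.toReal_zero]
    · rw [Set.indicator_of_mem (by simpa using ha), if_neg ha]
  -- assemble
  have htv : ν.tvDist μ = ∑' a, max (m a - n a) 0 := by
    unfold PMF.tvDist
    change 2⁻¹ * ∑' a, |n a - m a| = _
    simp_rw [habs]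
    rw [(hnsum.sub hmsum).tsum_add (hmaxsum.mul_left 2), tsum_mul_left, hnsum.tsum_sub hmsum, hn1, hm1]
    ring
  rw [htv]
  calc ∑' a, max (m a - n a) 0 ≤ ∑' a, g a := hmaxsum.tsum_le_tsum hpos hgsum
    _ = ∑' a, ((if a ∈ S then (F - 1) * n a else 0) + (if a ∈ S then 0 else m a)) := tsum_congr hgsplit
    _ = ∑' a, (if a ∈ S then (F - 1) * n a else 0) + ∑' a, (if a ∈ S then 0 else m a) :=
        hg1sum.tsum_add hg2sum
    _ ≤ (F - 1) + (μ.toOuterMeasure ((↑S : Set α)ᶜ)).toReal := by rw [h2]; linarith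

/-! ### The matched parameter `s = √π/h` and the discrete Gaussian at it -/

namespace PGParams

variable (P : PGParams)

/-- **The Gaussian parameter matched by the sampler**: `s = √π/h = 2ᵇ√π`, for which
`ρ_s(j) = e^{-πj²/s²} = e^{-(jh)²}` is the sampler's ideal acceptance profile. [folklore] -/
def sZ : ℝ := √π / P.h

/-- `s > 0`. [folklore] -/
theorem sZ_pos : 0 < P.sZ := div_pos (sqrt_pos.2 pi_pos) P.h_pos

/-- `s = 2ᵇ √π`. [folklore] -/
theorem sZ_eq : P.sZ = (2 : ℝ) ^ P.b * √π := by
  unfold sZ PGParams.h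
  rw [div_inv_eq_mul, mul_comm]

/-- **`ρ_s(x) = e^{-(xh)²}`** at `s = √π/h`. [folklore] -/
theorem gaussianFunction_sZ (x : ℝ) : gaussianFunction P.sZ x = exp (-(x * P.h) ^ 2) := by
  unfold gaussianFunction sZ
  congr 1
  rw [Real.norm_eq_abs, sq_abs, div_pow, Real.sq_sqrt pi_pos.le]
  have hh := P.h_pos
  field_simp

/-- The Gaussian weights `e^{-(jh)²}` are summable over `ℤ`. [folklore] -/
theorem summable_exp_neg_sq : Summable fun j : ℤ => exp (-((j : ℝ) * P.h) ^ 2) := by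
  have h := summable_gaussianFunction_sub intLattice P.sZ_pos.ne' (0 : ℝ)
  have h2 : Summable fun j : ℤ => gaussianFunction P.sZ (((intLatticeEquiv j : intLattice) : ℝ) - 0) :=
    (intLatticeEquiv.summable_iff (f := fun x : intLattice => gaussianFunction P.sZ ((x : ℝ) - 0))).2 h
  refine h2.congr fun j => ?_
  rw [coe_intLatticeEquiv, sub_zero, gaussianFunction_sZ]

/-- **The normalising sum `Z = ρ_s(ℤ) = ∑_{j ∈ ℤ} e^{-(jh)²}`** as a real number. [folklore] -/
def Z : ℝ := ∑' j : ℤ, exp (-((j : ℝ) * P.h) ^ 2)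

/-- `ρ_s(ℤ)` in `ℝ≥0∞` is `Z`. [folklore] -/
theorem gaussianMassInt_sZ : gaussianMassInt P.sZ 0 = ENNReal.ofReal P.Z := by
  unfold gaussianMassInt Z
  rw [ENNReal.ofReal_tsum_of_nonneg (fun j => (exp_pos _).le) P.summable_exp_neg_sq]
  refine tsum_congr fun j => ?_
  rw [sub_zero, gaussianFunction_sZ]

/-- `Z > 0` (the term `j = 0` alone is `1`). [folklore] -/
theorem Z_pos : 0 < P.Z := by
  unfold Z
  exact P.summable_exp_neg_sq.tsum_pos (fun j => (exp_pos _).le) 0 (exp_pos _)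

/-- **`D_{ℤ,s,0}(j) = e^{-(jh)²}/Z`** at `s = √π/h`. [cite: GentryPeikertVaikuntanathan2008, §4.1] -/
theorem toReal_discreteGaussianInt_sZ (j : ℤ) :
    (discreteGaussianInt P.sZ 0 j).toReal = exp (-((j : ℝ) * P.h) ^ 2) / P.Z := by
  rw [discreteGaussianInt_apply P.sZ_pos, gaussianMassInt_sZ, ENNReal.toReal_mul, ENNReal.toReal_inv,
    ENNReal.toReal_ofReal (gaussianFunction_pos _ _).le, ENNReal.toReal_ofReal P.Z_pos.le, sub_zero,
    gaussianFunction_sZ, div_eq_mul_inv]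

/-- Finite partial sums are below `Z`. [folklore] -/
theorem sum_le_Z (S : Finset ℤ) : ∑ j ∈ S, exp (-((j : ℝ) * P.h) ^ 2) ≤ P.Z :=
  P.summable_exp_neg_sq.sum_le_tsum S fun _ _ => (exp_pos _).le

/-! ### The mass of the range: `∑_{|j|<T} e^{-(jh)²} ≥ (√π - 2e^{-R})/h - 1` -/

/-- **Riemann lower bound for the range**: `(√π - 2e^{-R})/h - 1 ≤ ∑_{|j|<T} e^{-(jh)²}` (the sum
over `(-T, T)` is `2∑_{0 ≤ j < T} - 1`, and `∑_{0≤j<T} e^{-h²j²} ≥ (√π/2 - e^{-hT})/h`,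
`Literature.Analysis.SpecialFunctions.le_sum_range_exp_neg_mul_sq`, `hT = R ≥ 1`). [folklore] -/
theorem le_sum_Ioo_exp_neg_sq :
    (√π - 2 * exp (-P.R)) / P.h - 1 ≤ ∑ j ∈ Ioo (-(P.T : ℤ)) P.T, exp (-((j : ℝ) * P.h) ^ 2) := by
  have hh := P.h_pos
  have hR1 : 1 ≤ P.R := by
    unfold PGParams.R; exact one_le_pow₀ (by norm_num)
  -- the sum over `(-T, T)` as `2 ∑_{0 ≤ j < T} - 1`
  set f : ℤ → ℝ := fun j => exp (-((j : ℝ) * P.h) ^ 2) with hf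
  have hfeven : ∀ j, f (-j) = f j := fun j => by simp [hf]
  have hsplit : ∑ j ∈ Ioo (-(P.T : ℤ)) P.T, f j = 2 * ∑ a ∈ Finset.range P.T, f a - 1 := by
    have hT := P.T_pos
    -- `Ioo (-T) T = {0} ∪ (Ioo 0 T) ∪ (Ioo (-T) 0)` and the negative part mirrors the positive part
    have e1 : ∑ j ∈ Ioo (-(P.T : ℤ)) P.T, f j =
        ∑ j ∈ Ico (0 : ℤ) P.T, f j + ∑ j ∈ Ioo (-(P.T : ℤ)) 0, f j := by
      rw [← Finset.sum_union]
      · congr 1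
        ext j; simp only [mem_Ioo, mem_union, mem_Ico]; omega
      · rw [Finset.disjoint_left]; intro j h1 h2; simp only [mem_Ico, mem_Ioo] at h1 h2; omega
    have e2 : ∑ j ∈ Ioo (-(P.T : ℤ)) 0, f j = ∑ j ∈ Ioo (0 : ℤ) P.T, f j := by
      refine Finset.sum_nbij' (fun j => -j) (fun j => -j) ?_ ?_ (fun j _ => by ring) (fun j _ => by ring)
        (fun j _ => (hfeven j).symm)
      · intro j hj; simp only [mem_Ioo] at hj ⊢; omega
      · intro j hj; simp only [mem_Ioo] at hj ⊢; omega
    have e3 : ∑ j ∈ Ico (0 : ℤ) P.T, f j = f 0 + ∑ j ∈ Ioo (0 : ℤ) P.T, f j := by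
      rw [← Finset.sum_insert (s := Ioo (0 : ℤ) P.T) (a := 0) (by simp)]
      congr 1; ext j; simp only [mem_Ico, mem_insert, mem_Ioo]; omega
    have e4 : ∑ j ∈ Ico (0 : ℤ) P.T, f j = ∑ a ∈ Finset.range P.T, f a := by
      rw [Finset.range_eq_Ico]
      refine Finset.sum_nbij' (fun j => j.toNat) (fun a => (a : ℤ)) ?_ ?_ ?_ (fun a _ => by simp) ?_
      · intro j hj; simp only [mem_Ico] at hj ⊢; omega
      · intro a ha; simp only [mem_Ico] at ha ⊢; omega
      · intro j hj; simp only [mem_Ico] at hj; exact Int.toNat_of_nonneg hj.1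
      · intro j hj; simp only [mem_Ico] at hj
        simp only [hf, Int.toNat_of_nonneg hj.1]
    have h0 : f 0 = 1 := by simp [hf]
    rw [e1, e2, e3, h0, ← e4, e3, h0]; ring
  rw [hsplit]
  -- the Riemann lower bound with `c = h²`, `√c T = hT = R ≥ 1`
  have hc : 0 < P.h ^ 2 := by positivity
  have hsc : √(P.h ^ 2) = P.h := Real.sqrt_sq hh.le
  have hL : 1 ≤ √(P.h ^ 2) * P.T := by rw [hsc, mul_comm, T_mul_h]; exact hR1
  have hrs := Literature.Analysis.SpecialFunctions.le_sum_range_exp_neg_mul_sq hc P.T hL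
  rw [hsc, show P.h * (P.T : ℝ) = P.R by rw [mul_comm, T_mul_h]] at hrs
  have hre : ∑ a ∈ Finset.range P.T, exp (-P.h ^ 2 * (a : ℝ) ^ 2) = ∑ a ∈ Finset.range P.T, f a := by
    refine Finset.sum_congr rfl fun a _ => ?_
    simp only [hf, Int.cast_natCast]; congr 1; ring
  rw [hre] at hrs
  calc (√π - 2 * exp (-P.R)) / P.h - 1 = 2 * ((√π / 2 - exp (-P.R)) / P.h) - 1 := by field_simp
    _ ≤ 2 * ∑ a ∈ Finset.range P.T, f a - 1 := by linarith

/-- Hence **`Z ≥ (√π - 2e^{-R})/h - 1`**, and `hZ ≥ √π - 2e^{-R} - h`. [folklore] -/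
theorem le_Z : (√π - 2 * exp (-P.R)) / P.h - 1 ≤ P.Z :=
  P.le_sum_Ioo_exp_neg_sq.trans (P.sum_le_Z _)

/-- Numerical positivity: `√π - 2e^{-R} - h ≥ 2/5` for `b ≥ 1` (`h ≤ ½`, `R ≥ 1`, `√π > 1.7`,
`2e^{-1} < 0.75`). [folklore] -/
theorem two_fifths_le (hb : 1 ≤ P.b) : 2 / 5 ≤ √π - 2 * exp (-P.R) - P.h := by
  have hR1 : 1 ≤ P.R := by unfold PGParams.R; exact one_le_pow₀ (by norm_num)
  have hh : P.h ≤ 1 / 2 := by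
    unfold PGParams.h
    rw [one_div]
    exact inv_anti₀ (by norm_num) (by simpa using pow_le_pow_right₀ (by norm_num : (1 : ℝ) ≤ 2) hb)
  have hpi : (17 / 10 : ℝ) ≤ √π := by
    rw [Real.le_sqrt (by norm_num) pi_pos.le]; nlinarith [Real.pi_gt_three]
  have hexp : exp (-P.R) ≤ 3 / 8 := by
    have h1 : exp (-P.R) ≤ exp (-1) := exp_le_exp.2 (by linarith)
    have h2 : exp (-1) ≤ (3 / 8 : ℝ) := by
      rw [Real.exp_neg, inv_le_comm₀ (exp_pos _) (by norm_num)]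
      have := Real.exp_one_gt_d9; norm_num at this ⊢; linarith
    exact h1.trans h2
  linarith

/-! ### The tail: `∑_{|j| ≥ T} e^{-(jh)²}` -/

/-- **One-sided Gaussian tail sum**: `∑_{T ≤ j < N} e^{-(jh)²} ≤ e^{-(R-h)²}/(h(R-h))` when `R - h > 0`
(`R - h = (T-1)h`): each term is at most `∫_{j-1}^{j} e^{-(xh)²} dx` (antitone Riemann sum), on
`[T-1, ∞)` one has `e^{-(xh)²} ≤ e^{-h²(T-1)x}`, and `∫_{T-1}^∞ e^{-h²(T-1)x} dx = e^{-h²(T-1)²}/(h²(T-1))`.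
[folklore] -/
theorem sum_Ico_exp_neg_sq_le (hRh : 0 < P.R - P.h) {N : ℕ} (hN : P.T ≤ N) :
    ∑ j ∈ Finset.Ico P.T N, exp (-((j : ℝ) * P.h) ^ 2) ≤ exp (-(P.R - P.h) ^ 2) / (P.h * (P.R - P.h)) := by
  have hh := P.h_pos
  have hT1 : 1 ≤ P.T := P.T_pos
  set L : ℕ := P.T - 1 with hLdef
  have hTL : P.T = L + 1 := by omega
  have hLh : (L : ℝ) * P.h = P.R - P.h := by
    rw [hLdef, Nat.cast_sub hT1, Nat.cast_one, sub_mul, one_mul, T_mul_h]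
  have hLpos : 0 < (L : ℝ) := by
    by_contra h0
    have : (L : ℝ) * P.h ≤ 0 := mul_nonpos_of_nonpos_of_nonneg (not_lt.1 h0) hh.le
    linarith
  -- the terms as an antitone function of a real variable
  set f : ℝ → ℝ := fun x => exp (-(P.h ^ 2) * x ^ 2) with hf
  have hterm : ∀ j : ℕ, exp (-((j : ℝ) * P.h) ^ 2) = f j := by
    intro j; simp only [hf]; congr 1; ring
  have hanti : AntitoneOn f (Set.Icc (L : ℝ) ((N - 1 : ℕ) : ℝ)) :=
    (Literature.Analysis.SpecialFunctions.antitoneOn_exp_neg_mul_sq (sq_nonneg P.h)).mono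
      (fun x hx => Set.mem_Ici.2 (hLpos.le.trans hx.1))
  -- reindex `j = i + 1`, `i ∈ [L, N-1)`
  have hLN : L ≤ N - 1 := by omega
  have hsum : ∑ j ∈ Finset.Ico P.T N, exp (-((j : ℝ) * P.h) ^ 2) =
      ∑ i ∈ Finset.Ico L (N - 1), f ((i + 1 : ℕ) : ℝ) := by
    rw [hTL, show N = (N - 1) + 1 by omega, ← Finset.sum_Ico_add' (fun j : ℕ => exp (-((j : ℝ) * P.h) ^ 2)) L (N - 1) 1]
    · exact Finset.sum_congr rfl fun i _ => hterm _
  rw [hsum]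
  have hRiem := hanti.sum_le_integral_Ico hLN
  -- compare with the exponential `g(x) = e^{-h²L x}` on `[L, N-1]`
  set a : ℝ := -(P.h ^ 2 * L) with ha
  have ha0 : a < 0 := by rw [ha]; nlinarith [mul_pos (pow_pos hh 2) hLpos]
  have hfg : ∀ x ∈ Set.Icc (L : ℝ) ((N - 1 : ℕ) : ℝ), f x ≤ exp (a * x) := by
    intro x hx
    simp only [hf]
    apply exp_le_exp.2
    rw [ha]
    have hxL : (L : ℝ) ≤ x := hx.1
    have hx0 : 0 ≤ x := hLpos.le.trans hxL
    nlinarith [mul_nonneg (pow_pos hh 2).le (mul_nonneg hx0 (sub_nonneg.2 hxL))]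
  have hab : (L : ℝ) ≤ ((N - 1 : ℕ) : ℝ) := by exact_mod_cast hLN
  have hfc : Continuous f := by
    simp only [hf]; fun_prop
  have hgc : Continuous fun x : ℝ => exp (a * x) := by fun_prop
  have hint1 : ∫ x in (L : ℝ)..((N - 1 : ℕ) : ℝ), f x ≤ ∫ x in (L : ℝ)..((N - 1 : ℕ) : ℝ), exp (a * x) :=
    intervalIntegral.integral_mono_on hab (hfc.intervalIntegrable _ _) (hgc.intervalIntegrable _ _) hfg
  -- the exponential integral over `[L, ∞)`
  have hint2 : ∫ x in (L : ℝ)..((N - 1 : ℕ) : ℝ), exp (a * x) ≤ ∫ x in Set.Ioi (L : ℝ), exp (a * x) := by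
    rw [intervalIntegral.integral_of_le hab]
    exact setIntegral_mono_set (integrableOn_exp_mul_Ioi ha0 _)
      (Filter.Eventually.of_forall fun x => (exp_pos _).le) (Filter.Eventually.of_forall fun x hx => hx.1)
  have hval : ∫ x in Set.Ioi (L : ℝ), exp (a * x) = exp (-(P.R - P.h) ^ 2) / (P.h * (P.R - P.h)) := by
    rw [integral_exp_mul_Ioi ha0, ha]
    have e1 : -(P.h ^ 2 * L) * L = -(P.R - P.h) ^ 2 := by rw [← hLh]; ring
    have e2 : -(P.h ^ 2 * (L : ℝ)) = -(P.h * (P.R - P.h)) := by rw [← hLh]; ring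
    rw [e1, e2, neg_div_neg_eq]
  calc ∑ i ∈ Finset.Ico L (N - 1), f ((i + 1 : ℕ) : ℝ) ≤ ∫ x in (L : ℝ)..((N - 1 : ℕ) : ℝ), f x := hRiem
    _ ≤ ∫ x in Set.Ioi (L : ℝ), exp (a * x) := hint1.trans hint2
    _ = _ := hval

/-- The tail bound as a bound on shifted partial sums: `∑_{i<n} e^{-((i+T)h)²} ≤ e^{-(R-h)²}/(h(R-h))`.
[folklore] -/
theorem sum_range_shift_exp_neg_sq_le (hRh : 0 < P.R - P.h) (n : ℕ) :
    ∑ i ∈ Finset.range n, exp (-(((i + P.T : ℕ) : ℝ) * P.h) ^ 2) ≤ exp (-(P.R - P.h) ^ 2) / (P.h * (P.R - P.h)) := by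
  have h := P.sum_Ico_exp_neg_sq_le hRh (N := P.T + n) (Nat.le_add_right _ _)
  rw [Finset.sum_Ico_eq_sum_range, Nat.add_sub_cancel_left] at h
  refine le_trans (le_of_eq (Finset.sum_congr rfl fun i _ => ?_)) h
  rw [add_comm]

/-- **The tail of `D_{ℤ,s,0}` beyond the range**: `D{|j| ≥ T} ≤ 2e^{-(R-h)²}/(h(R-h)Z)`. [folklore] -/
theorem discreteGaussianInt_tail_le (hRh : 0 < P.R - P.h) :
    ((discreteGaussianInt P.sZ 0).toOuterMeasure ((↑(Ioo (-(P.T : ℤ)) P.T) : Set ℤ)ᶜ)).toReal ≤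
      2 * (exp (-(P.R - P.h) ^ 2) / (P.h * (P.R - P.h))) / P.Z := by
  set μ := discreteGaussianInt P.sZ 0 with hμ
  set B : ℝ := exp (-(P.R - P.h) ^ 2) / (P.h * (P.R - P.h)) with hB
  have hZ := P.Z_pos
  have hT1 : 1 ≤ P.T := P.T_pos
  -- the shifted tail series `∑_m D(m + T) ≤ B/Z`
  set g : ℕ → ℝ := fun m => (μ ((m + P.T : ℕ) : ℤ)).toReal with hg
  have hg_nonneg : ∀ m, 0 ≤ g m := fun m => ENNReal.toReal_nonneg
  have hg_eq : ∀ m, g m = exp (-(((m + P.T : ℕ) : ℝ) * P.h) ^ 2) / P.Z := by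
    intro m; simp only [hg, hμ, toReal_discreteGaussianInt_sZ, Int.cast_natCast]
  have hgle : ∑' m, g m ≤ B / P.Z := by
    refine Real.tsum_le_of_sum_range_le hg_nonneg fun n => ?_
    simp only [hg_eq, div_eq_mul_inv, ← Finset.sum_mul]
    rw [← div_eq_mul_inv, ← div_eq_mul_inv, div_le_div_iff_of_pos_right hZ]
    exact P.sum_range_shift_exp_neg_sq_le hRh n
  -- the indicator series of the right and left tails, over `ℤ = ℕ ⊔ -(ℕ+1)`
  have hμsum : Summable fun j : ℤ => (μ j).toReal := PMF.summable_coe_toReal μ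
  set kf : ℤ → ℝ := fun j => if (P.T : ℤ) ≤ j then (μ j).toReal else 0 with hkf
  set kf' : ℤ → ℝ := fun j => if j ≤ -(P.T : ℤ) then (μ j).toReal else 0 with hkf'
  have hkf_nonneg : ∀ j, 0 ≤ kf j := fun j => by simp only [hkf]; split_ifs <;> simp
  have hkf'_nonneg : ∀ j, 0 ≤ kf' j := fun j => by simp only [hkf']; split_ifs <;> simp
  have hkfsum : Summable kf := Summable.of_nonneg_of_le hkf_nonneg
    (fun j => by simp only [hkf]; split_ifs <;> simp) hμsum
  have hkf'sum : Summable kf' := Summable.of_nonneg_of_le hkf'_nonneg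
    (fun j => by simp only [hkf']; split_ifs <;> simp) hμsum
  -- evenness of `D_{ℤ,s,0}`
  have heven : ∀ j : ℤ, (μ (-j)).toReal = (μ j).toReal := by
    intro j; simp only [hμ, toReal_discreteGaussianInt_sZ, Int.cast_neg]; congr 2; ring
  -- (a) the right tail `∑ kf = ∑_m g m`
  have hkN : (fun n : ℕ => kf n) = fun n => if P.T ≤ n then (μ n).toReal else 0 := by
    funext n; simp only [hkf, Nat.cast_le]
  have hshift : ∑' n : ℕ, (if P.T ≤ n then (μ n).toReal else 0) = ∑' m, g m := by
    have hs : Summable fun n : ℕ => if P.T ≤ n then (μ n).toReal else 0 := by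
      have := hkfsum.comp_injective Nat.cast_injective
      rwa [show (kf ∘ Nat.cast) = fun n : ℕ => kf n from rfl, hkN] at this
    rw [← Summable.sum_add_tsum_nat_add P.T hs, Finset.sum_eq_zero (fun i hi => by
      rw [Finset.mem_range] at hi; rw [if_neg (by omega)]), zero_add]
    refine tsum_congr fun m => ?_
    rw [if_pos (Nat.le_add_left _ _)]
  have hkf_tsum : ∑' j, kf j = ∑' m, g m := by
    rw [tsum_of_nat_of_neg_add_one (hkfsum.comp_injective Nat.cast_injective)
      (hkfsum.comp_injective (fun a b h => by simpa using h)), ← hshift, hkN]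
    have hz : (fun n : ℕ => kf (-(n + 1 : ℤ))) = fun _ => 0 := by
      funext n; simp only [hkf]; rw [if_neg (by omega)]
    rw [hz, tsum_zero, add_zero]
  -- (b) the left tail `∑ kf' = ∑_m g m`
  have hkf'_tsum : ∑' j, kf' j = ∑' m, g m := by
    rw [tsum_of_nat_of_neg_add_one (hkf'sum.comp_injective Nat.cast_injective)
      (hkf'sum.comp_injective (fun a b h => by simpa using h))]
    have hz : (fun n : ℕ => kf' (n : ℤ)) = fun _ => 0 := by
      funext n; simp only [hkf']; rw [if_neg (by omega)]
    rw [hz, tsum_zero, zero_add]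
    -- `kf' (-(n+1)) = k (n+1)` with `k m = [T ≤ m] D(m)`
    set k : ℕ → ℝ := fun m => if P.T ≤ m then (μ m).toReal else 0 with hk
    have hks : Summable k := by
      have := hkfsum.comp_injective Nat.cast_injective
      rwa [show (kf ∘ Nat.cast) = fun n : ℕ => kf n from rfl, hkN] at this
    have hkk : (fun n : ℕ => kf' (-(n + 1 : ℤ))) = fun n => k (n + 1) := by
      funext n
      simp only [hkf', hk]
      have e : (-(n + 1 : ℤ)) = -((n + 1 : ℕ) : ℤ) := by push_cast; ring
      rw [e, heven]
      by_cases hn : P.T ≤ n + 1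
      · rw [if_pos (by omega), if_pos hn]
      · rw [if_neg (by omega), if_neg hn]
    rw [hkk, ← hshift]
    have h0 : k 0 = 0 := by simp only [hk]; rw [if_neg (by omega)]
    have := hks.tsum_eq_zero_add
    rw [h0, zero_add] at this
    exact this.symm
  -- the complement of the range is the union of the two tails
  have hsub : (↑(Ioo (-(P.T : ℤ)) P.T) : Set ℤ)ᶜ ⊆ {j : ℤ | (P.T : ℤ) ≤ j} ∪ {j : ℤ | j ≤ -(P.T : ℤ)} := by
    intro j hj
    simp only [Set.mem_compl_iff, mem_coe, mem_Ioo, not_and_or, not_lt] at hj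
    simp only [Set.mem_union, Set.mem_setOf_eq]
    rcases hj with hj | hj
    · exact Or.inr hj
    · exact Or.inl hj
  have htoReal : ∀ (pr : ℤ → Prop) [DecidablePred pr],
      (μ.toOuterMeasure {j | pr j}).toReal = ∑' j, (if pr j then (μ j).toReal else 0) := by
    intro pr _
    rw [PMF.toOuterMeasure_apply, ENNReal.tsum_toReal_eq (fun j => by
      refine ne_top_of_le_ne_top (PMF.apply_ne_top μ j) (Set.indicator_le_self _ _ j))]
    refine tsum_congr fun j => ?_
    by_cases hj : pr j
    · rw [Set.indicator_of_mem (by simpa using hj), if_pos hj]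
    · rw [Set.indicator_of_notMem (by simpa using hj), if_neg hj, ENNReal.toReal_zero]
  have hA : (μ.toOuterMeasure {j : ℤ | (P.T : ℤ) ≤ j}).toReal = ∑' m, g m :=
    (htoReal fun j => (P.T : ℤ) ≤ j).trans hkf_tsum
  have hA' : (μ.toOuterMeasure {j : ℤ | j ≤ -(P.T : ℤ)}).toReal = ∑' m, g m :=
    (htoReal fun j => j ≤ -(P.T : ℤ)).trans hkf'_tsum
  have hne : ∀ A : Set ℤ, μ.toOuterMeasure A ≠ ∞ := fun A =>
    ne_top_of_le_ne_top ENNReal.one_ne_top ((μ.toOuterMeasure.mono (Set.subset_univ A)).trans_eq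
      ((PMF.toOuterMeasure_apply_eq_one_iff μ Set.univ).2 (Set.subset_univ _)))
  calc (μ.toOuterMeasure ((↑(Ioo (-(P.T : ℤ)) P.T) : Set ℤ)ᶜ)).toReal
      ≤ (μ.toOuterMeasure ({j : ℤ | (P.T : ℤ) ≤ j} ∪ {j : ℤ | j ≤ -(P.T : ℤ)})).toReal :=
        ENNReal.toReal_mono (hne _) (μ.toOuterMeasure.mono hsub)
    _ ≤ (μ.toOuterMeasure {j : ℤ | (P.T : ℤ) ≤ j}).toReal + (μ.toOuterMeasure {j : ℤ | j ≤ -(P.T : ℤ)}).toReal := by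
        rw [← ENNReal.toReal_add (hne _) (hne _)]
        exact ENNReal.toReal_mono (ENNReal.add_ne_top.2 ⟨hne _, hne _⟩) (measure_union_le _ _)
    _ = 2 * ∑' m, g m := by rw [hA, hA']; ring
    _ ≤ 2 * (B / P.Z) := by linarith
    _ = 2 * B / P.Z := by ring

/-! ### The domination on the range and the statistical distance -/

/-- **The discrete Gaussian is dominated by the sampler's law on the range**: for `k, b ≥ 1`,
`p₀^J < 1` and `|j| < T`,
`D_{ℤ,s,0}(j) ≤ F · ℓ'(j)`, `F = e^{2qR² + q}(√π + h)/((1 - p₀^J)(√π - 2e^{-R} - h))`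
(`ℓ'(j) ≥ (1 - p₀^J)φ(j)/A`, `φ(j) ≥ e^{-(1+2q)(jh)²} ≥ e^{-2qR²}e^{-(jh)²}`, `A ≤ e^q(1 + √π/h)`,
`Z ≥ (√π - 2e^{-R} - h)/h`). [folklore] -/
theorem discreteGaussianInt_le_mul_law (hk : 1 ≤ P.k) (hb : 1 ≤ P.b) (hJ : P.pNone ^ P.J < 1)
    {j : ℤ} (hj : j.natAbs < P.T) :
    (discreteGaussianInt P.sZ 0 j).toReal ≤
      exp (2 * P.q * P.R ^ 2 + P.q) * (√π + P.h) / ((1 - P.pNone ^ P.J) * (√π - 2 * exp (-P.R) - P.h)) *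
        P.law j := by
  have hh := P.h_pos
  have hq := P.q_pos
  have hZ := P.Z_pos
  have hden := P.two_fifths_le hb
  have hJ' : 0 < 1 - P.pNone ^ P.J := by linarith
  have hApos : 0 < P.A := lt_of_lt_of_le one_pos P.one_le_A
  set a : ℕ := j.natAbs with hadef
  set ρ : ℝ := exp (-((j : ℝ) * P.h) ^ 2) with hρ
  -- `ρ = e^{-(ah)²}` and `(ah)² < R²`
  have hja : ((a : ℕ) : ℝ) ^ 2 = (j : ℝ) ^ 2 := by
    rw [hadef, Nat.cast_natAbs, Int.cast_abs, sq_abs]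
  have hρa : ρ = exp (-((a : ℝ) * P.h) ^ 2) := by
    rw [hρ]; congr 2; rw [mul_pow, mul_pow, hja]
  have haR : ((a : ℝ) * P.h) ^ 2 ≤ P.R ^ 2 := by
    have h1 : (a : ℝ) * P.h ≤ P.R := by
      rw [← T_mul_h]
      exact mul_le_mul_of_nonneg_right (by exact_mod_cast hj.le) hh.le
    exact pow_le_pow_left₀ (by positivity) h1 2
  -- lower bound on `ℓ'(j)`
  have hphi : exp (-2 * P.q * P.R ^ 2) * ρ ≤ P.phi j := by
    have h := P.exp_le_phi hk hj
    have hphia : P.phi (a : ℤ) = P.phi j := by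
      rcases Int.natAbs_eq j with h' | h'
      · rw [hadef, ← h']
      · rw [hadef, show ((j.natAbs : ℕ) : ℤ) = -j by omega, phi_neg]
    rw [hphia] at h
    refine le_trans ?_ h
    rw [hρa, ← Real.exp_add]
    apply exp_le_exp.2
    nlinarith [hq.le, haR]
  have hlaw : (1 - P.pNone ^ P.J) * exp (-2 * P.q * P.R ^ 2) * ρ / (exp P.q * (1 + √π / P.h)) ≤ P.law j := by
    have h1 := P.phi_div_mul_le_law j
    have hAle := P.A_le hk
    calc (1 - P.pNone ^ P.J) * exp (-2 * P.q * P.R ^ 2) * ρ / (exp P.q * (1 + √π / P.h))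
        ≤ (1 - P.pNone ^ P.J) * exp (-2 * P.q * P.R ^ 2) * ρ / P.A := by
          apply div_le_div_of_nonneg_left _ hApos hAle
          exact mul_nonneg (mul_nonneg hJ'.le (exp_pos _).le) (exp_pos _).le
      _ ≤ (1 - P.pNone ^ P.J) * P.phi j / P.A := by
          rw [mul_assoc]
          exact div_le_div_of_nonneg_right (mul_le_mul_of_nonneg_left hphi hJ'.le) hApos.le
      _ = P.phi j / P.A * (1 - P.pNone ^ P.J) := by ring
      _ ≤ P.law j := h1
  -- upper bound on `D(j) = ρ/Z`
  have hZlo : (√π - 2 * exp (-P.R) - P.h) / P.h ≤ P.Z := by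
    have := P.le_Z
    rw [show (√π - 2 * exp (-P.R)) / P.h - 1 = (√π - 2 * exp (-P.R) - P.h) / P.h by field_simp] at this
    exact this
  rw [toReal_discreteGaussianInt_sZ, ← hρ]
  have hρpos : 0 < ρ := exp_pos _
  -- `ρ/Z ≤ ρ h/(√π - 2e^{-R} - h)`
  have hD : ρ / P.Z ≤ ρ * P.h / (√π - 2 * exp (-P.R) - P.h) := by
    rw [div_le_div_iff₀ hZ (by linarith)]
    have := mul_le_mul_of_nonneg_left hZlo (mul_nonneg hρpos.le hh.le)
    calc ρ * (√π - 2 * exp (-P.R) - P.h) = ρ * P.h * ((√π - 2 * exp (-P.R) - P.h) / P.h) := by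
          field_simp
      _ ≤ ρ * P.h * P.Z := this
  refine hD.trans ?_
  -- combine with the lower bound on `ℓ'(j)`
  have hkey : ρ * P.h / (√π - 2 * exp (-P.R) - P.h) =
      exp (2 * P.q * P.R ^ 2 + P.q) * (√π + P.h) / ((1 - P.pNone ^ P.J) * (√π - 2 * exp (-P.R) - P.h)) *
        ((1 - P.pNone ^ P.J) * exp (-2 * P.q * P.R ^ 2) * ρ / (exp P.q * (1 + √π / P.h))) := by
    set X : ℝ := exp (2 * P.q * P.R ^ 2) with hX
    set Y : ℝ := exp P.q with hY
    have hXpos : 0 < X := exp_pos _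
    have hYpos : 0 < Y := exp_pos _
    have eE : exp (2 * P.q * P.R ^ 2 + P.q) = X * Y := by rw [hX, hY, ← Real.exp_add]
    have eN : exp (-2 * P.q * P.R ^ 2) = X⁻¹ := by
      rw [hX, ← Real.exp_neg]; congr 1; ring
    rw [eE, eN]
    have hsp : 0 < √π := sqrt_pos.2 pi_pos
    field_simp
    ring
  rw [hkey]
  refine mul_le_mul_of_nonneg_left hlaw ?_
  exact div_nonneg (mul_nonneg (exp_pos _).le (by positivity)) (mul_nonneg hJ'.le (by linarith))

/-- **The pseudo-Gaussian sampler is close to the discrete Gaussian `D_{ℤ, 2ᵇ√π, 0}`**: for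
`k, b ≥ 1` and `p₀^J < 1`,
`Δ(ℓ', D_{ℤ,s,0}) ≤ (F - 1) + 2e^{-(R-h)²}/((R-h)(√π - 2e^{-R} - h))` with `s = √π/h = 2ᵇ√π` and
`F = e^{2qR² + q}(√π + h)/((1 - p₀^J)(√π - 2e^{-R} - h))` — one-sided domination on the range
(`discreteGaussianInt_le_mul_law`) plus the tail (`discreteGaussianInt_tail_le`, `Z ≥ (√π - 2e^{-R} - h)/h`).
Every term is small when `qR², q, h, p₀^J → 0` and `R → ∞`; with `2^{2r+k}` acceptance blocks the
accuracy is `Θ(R²2^{-k})`. [cite: GentryPeikertVaikuntanathan2008, §4.1 (SampleZ needs D_{ℤ,s,c} within small statistical distance)] -/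
theorem tvDist_lawPMF_discreteGaussianInt_le (hk : 1 ≤ P.k) (hb : 1 ≤ P.b) (hJ : P.pNone ^ P.J < 1) :
    P.lawPMF.tvDist (discreteGaussianInt P.sZ 0) ≤
      (exp (2 * P.q * P.R ^ 2 + P.q) * (√π + P.h) / ((1 - P.pNone ^ P.J) * (√π - 2 * exp (-P.R) - P.h)) - 1) +
        2 * exp (-(P.R - P.h) ^ 2) / ((P.R - P.h) * (√π - 2 * exp (-P.R) - P.h)) := by
  have hh := P.h_pos
  have hden := P.two_fifths_le hb
  have hJ' : 0 < 1 - P.pNone ^ P.J := by linarith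
  have hR1 : 1 ≤ P.R := by unfold PGParams.R; exact one_le_pow₀ (by norm_num)
  have hh2 : P.h ≤ 1 / 2 := by
    unfold PGParams.h; rw [one_div]
    exact inv_anti₀ (by norm_num) (by simpa using pow_le_pow_right₀ (by norm_num : (1 : ℝ) ≤ 2) hb)
  have hRh : 0 < P.R - P.h := by linarith
  have hsp : 0 ≤ √π := sqrt_nonneg π
  set F : ℝ := exp (2 * P.q * P.R ^ 2 + P.q) * (√π + P.h) /
    ((1 - P.pNone ^ P.J) * (√π - 2 * exp (-P.R) - P.h)) with hFdef
  -- `F ≥ 1`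
  have hF1 : 1 ≤ F := by
    rw [hFdef, le_div_iff₀ (mul_pos hJ' (by linarith)), one_mul]
    have h1 : 1 ≤ exp (2 * P.q * P.R ^ 2 + P.q) := Real.one_le_exp (by have := P.q_pos; positivity)
    have h2 : (1 - P.pNone ^ P.J) * (√π - 2 * exp (-P.R) - P.h) ≤ 1 * (√π + P.h) := by
      refine mul_le_mul (by linarith [pow_nonneg P.pNone_nonneg P.J]) ?_ (by linarith) zero_le_one
      linarith [exp_pos (-P.R)]
    calc (1 - P.pNone ^ P.J) * (√π - 2 * exp (-P.R) - P.h) ≤ 1 * (√π + P.h) := h2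
      _ ≤ exp (2 * P.q * P.R ^ 2 + P.q) * (√π + P.h) :=
          mul_le_mul_of_nonneg_right h1 (by linarith)
  have hgen := tvDist_le_of_le_mul_on P.lawPMF (discreteGaussianInt P.sZ 0) (Ioo (-(P.T : ℤ)) P.T)
    (fun j hj => P.lawPMF_apply_eq_zero (by
      simp only [mem_Ioo, not_and_or, not_lt] at hj
      rcases hj with hj | hj <;> omega)) hF1
    (fun j hj => by
      rw [toReal_lawPMF_apply]
      refine P.discreteGaussianInt_le_mul_law hk hb hJ ?_
      simp only [mem_Ioo] at hj; omega)
  -- the tail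
  have htail := P.discreteGaussianInt_tail_le hRh
  suffices hsuff : 2 * (exp (-(P.R - P.h) ^ 2) / (P.h * (P.R - P.h))) / P.Z ≤
      2 * exp (-(P.R - P.h) ^ 2) / ((P.R - P.h) * (√π - 2 * exp (-P.R) - P.h)) by
    linarith [hgen, htail, hsuff]
  have hZlo : (√π - 2 * exp (-P.R) - P.h) / P.h ≤ P.Z := by
    have := P.le_Z
    rw [show (√π - 2 * exp (-P.R)) / P.h - 1 = (√π - 2 * exp (-P.R) - P.h) / P.h by field_simp] at this
    exact this
  have hZ := P.Z_pos
  rw [div_le_div_iff₀ hZ (mul_pos hRh (by linarith))]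
  have hnum : 0 ≤ 2 * exp (-(P.R - P.h) ^ 2) := by positivity
  calc 2 * (exp (-(P.R - P.h) ^ 2) / (P.h * (P.R - P.h))) * ((P.R - P.h) * (√π - 2 * exp (-P.R) - P.h))
      = 2 * exp (-(P.R - P.h) ^ 2) * ((√π - 2 * exp (-P.R) - P.h) / P.h) := by field_simp
    _ ≤ 2 * exp (-(P.R - P.h) ^ 2) * P.Z := mul_le_mul_of_nonneg_left hZlo hnum

end PGParams

end Literature.Probability.Distributions

end
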